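import Literature.NumberTheory.Sieve.GreenTao2008Majorant
import Literature.NumberTheory.Sieve.GreenTao2008CorrelationLocal
import Literature.NumberTheory.Transcendental.MahlerManinEndgame
import HarnessLib

/-!
# Green–Tao (2008), Proposition 9.6 up to constants: the correlation estimate for `Λ_R`, proved

Assembly of the tree's ELEMENTARY proof of

  `E_{x ∈ [a, a+ℓ)} ∏_{i<m} Λ_R(W(x + h_i) + 1)² ≤ C_m (W log R/φ(W))^m ∏_{p ∣ Δ} (1 + C'_m p^{-1/2})`

for distinct integers `h_i`, `ℓ ≥ R^{5m}`, `R ≥ 2`, every prime factor of `W` at most `R`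
(`correlation_bound`): B. Green, T. Tao, Ann. of Math. 167 (2008), Proposition 9.6 with the printed
`1 + o_m(1)` weakened to `O_m(1)` — exactly what the proof of Proposition 9.10 consumes (the tree's
`GreenTao2008.MeasureCorrelation`, discharged from this file in `GreenTao2008MajorantProofs`). The
printed proof of Prop. 9.6 (§10 and the Appendix of the source) evaluates a contour integral against
`ζ` in the classical zero-free region; the bound up to constants is proved here without complex
analysis:

1. (expansion and Chinese remainder theorem, the tree's CFZ bricks `expect_prod_sq_divSum_eq`,
   `abs_sum_coef_mul_expect_sub_tupleDensity_le`, `tupleDensity_eq_prod_localDensity`)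
   `E ∏ Λ_R(θ_i)² = (log R)^{2m} (MAIN + O(R^{4m}/ℓ))`, and `MAIN` is the expectation, over the
   product probability space `Ω = ∏_{p ≤ R, p ∤ W} ℤ_p`, of `∏_i (Σ_V Λ(V) ∏_{p∈V} I_i(p, ω_p))²`
   (`main_eq_expect`);
2. (Selberg's change of variables and the local computations, `GreenTao2008CorrelationCore`,
   `GreenTao2008CorrelationLocal`) `MAIN ≤ Z^{2m} ∏_p (local factor)_p`,
   `Z = 7 (W/φ(W))/log R`, local factor `≤ (p/(p-1))^m (1 + O_m(p^{-2}))`, times `(1 + O_m(1/p))` at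
   the primes dividing some `h_i − h_j`;
3. (Mertens, the tree's `MertensBound.exp_neg_div_log_le_prod_one_sub_inv`)
   `(W/φ(W)) ∏_{p ≤ R, p ∤ W} p/(p−1) = ∏_{p ≤ R} p/(p−1) ≤ e⁵ log R`.

## References
* B. Green, T. Tao, *The primes contain arbitrarily long arithmetic progressions*, Ann. of Math. (2)
  167 (2008), 481–547, Proposition 9.6 (p. 526), §10. [cite: GreenTaoAnnals2008]
* D. Conlon, J. Fox, Y. Zhao, EMS Surv. Math. Sci. 1 (2014), §9 (the expansion and CRT steps reused
  here). [cite: ConlonFoxZhao2014]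
-/

noncomputable section

open Finset Real
open scoped BigOperators ArithmeticFunction.Moebius

namespace Literature.NumberTheory.Sieve.GreenTao2008

variable {m : ℕ}

/-! ### Step 1: expansion and the Chinese remainder theorem -/

section Expansion

/-- The constant coefficient system `L_{ij} = 1` (one variable, `θ_i(x) = W(x + h_i) + 1`).
[cite: GreenTaoAnnals2008, Proposition 9.6] -/
def oneForm (m : ℕ) : Fin m → Fin 1 → ℤ := fun _ _ => 1

/-- `θ_i` in the CFZ format is `W(x + h_i) + 1`. [cite: GreenTaoAnnals2008, Proposition 9.6] -/
theorem wForm_oneForm (W : ℕ) (h : Fin m → ℤ) (i : Fin m) (x : Fin 1 → ℤ) :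
    CFZ.wForm W (oneForm m i) (h i) x = (W : ℤ) * (x 0 + h i) + 1 := by
  unfold CFZ.wForm oneForm
  simp

/-- `Λ_R(θ) = log R · Σ_{d ≤ R, d ∣ θ} c(d)` with `c = corrCoef R`. [cite: GreenTaoAnnals2008, Definition 9.2] -/
theorem truncatedDivisorSum_eq_mul_divSum {R : ℝ} (hR : 1 < R) (n : ℤ) :
    truncatedDivisorSum R n = Real.log R * CFZ.divSum (corrCoef R) R n := by
  rw [truncatedDivisorSum_def]
  unfold CFZ.divSum
  rw [mul_sum]
  refine sum_congr rfl fun d hd => ?_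
  obtain ⟨hd', -⟩ := mem_filter.1 hd
  obtain ⟨h1, h2⟩ := mem_Icc.1 hd'
  have hdR : (d : ℝ) ≤ R := (show (d : ℝ) ≤ ⌊R⌋₊ by exact_mod_cast h2).trans (Nat.floor_le (by linarith))
  have hlogR : Real.log R ≠ 0 := (Real.log_pos hR).ne'
  rw [corrCoef_def, if_pos hdR]
  field_simp

/-- Averages over an integer interval are averages over the corresponding one-dimensional box.
[folklore] -/
theorem expect_Ico_eq_expect_box (a : ℤ) (ℓ : ℕ) (F : ℤ → ℝ) :
    𝔼 x ∈ Ico a (a + ℓ), F x = 𝔼 x ∈ Fintype.piFinset (fun _ : Fin 1 => Ico a (a + ℓ)), F (x 0) := by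
  refine expect_nbij' (fun x => fun _ => x) (fun y => y 0) (fun x hx => Fintype.mem_piFinset.2 fun _ => hx)
    (fun y hy => Fintype.mem_piFinset.1 hy 0) (fun x _ => rfl) (fun y _ => ?_) (fun x _ => rfl)
  funext j
  rw [Subsingleton.elim j 0]

/-- **Step 1a (expansion, CFZ (28))**:
`E_{x ∈ [a,a+ℓ)} ∏_i Λ_R(W(x+h_i)+1)² = (log R)^{2m} Σ_{dd} (∏_v c(dd_v)) E_{x} 1[dd ∣ θ(x)]`.
[cite: GreenTaoAnnals2008, Section 10 (10.1)] -/
theorem expect_prod_sq_eq_sum {R : ℝ} (hR : 1 < R) (W : ℕ) (h : Fin m → ℤ) (a : ℤ) (ℓ : ℕ) :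
    𝔼 x ∈ Ico a (a + ℓ), ∏ i, truncatedDivisorSum R (W * (x + h i) + 1) ^ 2 =
      Real.log R ^ (2 * m) * ∑ dd ∈ Fintype.piFinset (fun _ : Fin m ⊕ Fin m => Icc 1 ⌊R⌋₊),
        (∏ v, corrCoef R (dd v)) * 𝔼 x ∈ Fintype.piFinset (fun _ : Fin 1 => Ico a (a + ℓ)),
          (if ∀ j, ((dd (Sum.inl j) : ℤ) ∣ CFZ.wForm W (oneForm m j) (h j) x) ∧
              ((dd (Sum.inr j) : ℤ) ∣ CFZ.wForm W (oneForm m j) (h j) x) then (1 : ℝ) else 0) := by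
  rw [expect_Ico_eq_expect_box a ℓ (fun x => ∏ i, truncatedDivisorSum R (W * (x + h i) + 1) ^ 2),
    ← CFZ.expect_prod_sq_divSum_eq (corrCoef R) R (Real.log R) W (oneForm m) h]
  refine expect_congr rfl fun x _ => prod_congr rfl fun i _ => ?_
  rw [truncatedDivisorSum_eq_mul_divSum hR, wForm_oneForm]

/-- The main term after the Chinese remainder theorem: `Σ_{dd} (∏_v c(dd_v)) · tupleDensity(dd)`.
[cite: GreenTaoAnnals2008, Section 10 (10.2)] -/
def mainSum (R : ℝ) (W : ℕ) (h : Fin m → ℤ) : ℝ :=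
  ∑ dd ∈ Fintype.piFinset (fun _ : Fin m ⊕ Fin m => Icc 1 ⌊R⌋₊),
    (∏ v, corrCoef R (dd v)) * CFZ.tupleDensity W (oneForm m) h (fun j => dd (Sum.inl j)) (fun j => dd (Sum.inr j))

/-- **Step 1b (CRT with error, CFZ (28)→(29))**: for `ℓ ≥ R^{2m}`,
`|E ∏ Λ_R(θ_i)² − (log R)^{2m} · mainSum| ≤ (log R)^{2m} R^{4m}/ℓ`.
[cite: GreenTaoAnnals2008, Section 10 (10.1)–(10.2)] -/
theorem abs_expect_prod_sq_sub_main_le {R : ℝ} (hR : 1 < R) (W : ℕ) (h : Fin m → ℤ) (a : ℤ) {ℓ : ℕ}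
    (hℓ : R ^ (2 * m) ≤ ℓ) :
    |𝔼 x ∈ Ico a (a + ℓ), ∏ i, truncatedDivisorSum R (W * (x + h i) + 1) ^ 2 -
        Real.log R ^ (2 * m) * mainSum R W h| ≤ Real.log R ^ (2 * m) * (R ^ (4 * m) / ℓ) := by
  rw [expect_prod_sq_eq_sum hR]
  unfold mainSum
  rw [← mul_sub, ← sum_sub_distrib, abs_mul, abs_of_nonneg (pow_nonneg (Real.log_nonneg hR.le) _)]
  refine mul_le_mul_of_nonneg_left ?_ (pow_nonneg (Real.log_nonneg hR.le) _)
  have h1 := CFZ.abs_sum_coef_mul_expect_sub_tupleDensity_le (corrCoef R) (abs_corrCoef_le_one hR)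
    (fun d hd => corrCoef_eq_zero_of_not_squarefree R hd) hR.le W (oneForm m) h (fun _ : Fin 1 => a)
    (fun _ => ℓ) (fun _ => hℓ)
  simp only [Fin.sum_univ_one] at h1
  have heq : ∀ dd : Fin m ⊕ Fin m → ℕ,
      (∏ v, corrCoef R (dd v)) * 𝔼 x ∈ Fintype.piFinset (fun _ : Fin 1 => Ico a (a + ℓ)),
          (if ∀ j, ((dd (Sum.inl j) : ℤ) ∣ CFZ.wForm W (oneForm m j) (h j) x) ∧
              ((dd (Sum.inr j) : ℤ) ∣ CFZ.wForm W (oneForm m j) (h j) x) then (1 : ℝ) else 0) -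
        (∏ v, corrCoef R (dd v)) * CFZ.tupleDensity W (oneForm m) h (fun j => dd (Sum.inl j)) (fun j => dd (Sum.inr j)) =
      (∏ v, corrCoef R (dd v)) * ((𝔼 x ∈ Fintype.piFinset (fun j : Fin 1 => Ico ((fun _ => a) j) ((fun _ => a) j + (fun _ => ℓ) j)),
          (if ∀ j, ((dd (Sum.inl j) : ℤ) ∣ CFZ.wForm W (oneForm m j) (h j) x) ∧
              ((dd (Sum.inr j) : ℤ) ∣ CFZ.wForm W (oneForm m j) (h j) x) then (1 : ℝ) else 0)) -
        CFZ.tupleDensity W (oneForm m) h (fun j => dd (Sum.inl j)) (fun j => dd (Sum.inr j))) := by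
    intro dd; ring
  rw [sum_congr rfl fun dd _ => heq dd]
  calc _ ≤ R ^ (2 * m) * (R ^ (2 * m) / ℓ) := h1
    _ = R ^ (4 * m) / ℓ := by rw [← mul_div_assoc, ← pow_add]; ring_nf

end Expansion

/-! ### Step 2: the main term as an expectation over the product space -/

section Model

variable {N W : ℕ}

/-- The square-free numbers `≤ N` built from the primes of the model. [cite: GreenTaoAnnals2008, Section 10] -/
def sqfLevel (N W : ℕ) : Finset ℕ := (Icc 1 N).filter fun d => d ∈ CFZ.squarefreeOf (sievePrimes N W)

/-- Membership in `sqfLevel`. [cite: GreenTaoAnnals2008, Section 10] -/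
theorem mem_sqfLevel {d : ℕ} : d ∈ sqfLevel N W ↔ d ∈ CFZ.squarefreeOf (sievePrimes N W) ∧ d ≤ N := by
  unfold sqfLevel
  rw [mem_filter, mem_Icc]
  constructor
  · rintro ⟨⟨-, h2⟩, h3⟩; exact ⟨h3, h2⟩
  · rintro ⟨h1, h2⟩
    exact ⟨⟨Nat.pos_of_ne_zero ((CFZ.mem_squarefreeOf (sievePrimes_prime N W)).1 h1).1.ne_zero, h2⟩, h1⟩

/-- The indicator of `d ∣ θ_i` in the model: `∏_{p ∈ P, p ∣ d} I_i(p, ω_p)`.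
[cite: GreenTaoAnnals2008, Section 10 (10.3)] -/
def indProd (W : ℕ) (h : Fin m → ℤ) (i : Fin m) (d : ℕ) (ω : ∀ p : sievePrimes N W, ZMod (p : ℕ)) : ℝ :=
  ∏ p ∈ primeSet (sievePrimes N W) d, corrInd W h i p (ω p)

/-- **The local factor at one prime**: for `p ∈ P`, the CFZ local density of the union pattern is the
local expectation of the product of the indicators over the slots divisible by `p`.
[cite: GreenTaoAnnals2008, Section 10 (10.3)] -/
theorem localDensity₀_eq_expect (h : Fin m → ℤ) (dd : Fin m ⊕ Fin m → ℕ) (p : sievePrimes N W) :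
    CFZ.localDensity₀ (p : ℕ) W (oneForm m) h
        (CFZ.pattern (fun j => dd (Sum.inl j)) p ∪ CFZ.pattern (fun j => dd (Sum.inr j)) p) =
      𝔼 u : ZMod (p : ℕ), ∏ v ∈ univ.filter (fun v => (p : ℕ) ∣ dd v), corrInd W h (CFZ.slotIdx v) p u := by
  classical
  rw [CFZ.localDensity₀_eq, ← CFZ.expect_indicator_eq_localDensity]
  refine Fintype.expect_equiv (Equiv.funUnique (Fin 1) (ZMod (p : ℕ))) _ _ fun u => ?_
  rw [Equiv.funUnique_apply]
  simp only [corrInd_def, prod_boole]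
  have hiff : (∀ j ∈ CFZ.pattern (fun j => dd (Sum.inl j)) (p : ℕ) ∪ CFZ.pattern (fun j => dd (Sum.inr j)) (p : ℕ),
      CFZ.wForm W (oneForm m j) (h j) u = 0) ↔
      ∀ v ∈ univ.filter (fun v : Fin m ⊕ Fin m => (p : ℕ) ∣ dd v),
        (W : ZMod (p : ℕ)) * (u default + (h (CFZ.slotIdx v) : ZMod (p : ℕ))) + 1 = 0 := by
    have hw : ∀ j, CFZ.wForm W (oneForm m j) (h j) u = (W : ZMod (p : ℕ)) * (u default + (h j : ZMod (p : ℕ))) + 1 := by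
      intro j
      unfold CFZ.wForm oneForm
      simp [Fin.default_eq_zero]
    simp only [hw, mem_union, CFZ.pattern, mem_filter, mem_univ, true_and]
    constructor
    · intro H v hv
      rcases v with j | j
      · exact H j (Or.inl hv)
      · exact H j (Or.inr hv)
    · intro H j hj
      rcases hj with hj | hj
      · exact H (Sum.inl j) hj
      · exact H (Sum.inr j) hj
  by_cases hc : ∀ v ∈ univ.filter (fun v : Fin m ⊕ Fin m => (p : ℕ) ∣ dd v),
      (W : ZMod (p : ℕ)) * (u default + (h (CFZ.slotIdx v) : ZMod (p : ℕ))) + 1 = 0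
  · rw [if_pos (hiff.2 hc), if_pos hc]
  · rw [if_neg (fun H => hc (hiff.1 H)), if_neg hc]

/-- **The CRT weight as an expectation over the product space**: for a tuple of square-free numbers
built from the primes of the model, `tupleDensity(dd) = E_ω ∏_v ∏_{p ∣ dd_v} I_{idx v}(p, ω_p)`.
[cite: GreenTaoAnnals2008, Section 10 (10.2)–(10.3)] -/
theorem tupleDensity_eq_expect (h : Fin m → ℤ) {dd : Fin m ⊕ Fin m → ℕ}
    (hdd : ∀ v, dd v ∈ CFZ.squarefreeOf (sievePrimes N W)) :
    CFZ.tupleDensity W (oneForm m) h (fun j => dd (Sum.inl j)) (fun j => dd (Sum.inr j)) =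
      𝔼 ω : (∀ p : sievePrimes N W, ZMod (p : ℕ)), ∏ v, indProd W h (CFZ.slotIdx v) (dd v) ω := by
  classical
  have hP := sievePrimes_prime N W
  rw [CFZ.tupleDensity_eq_prod_localDensity W (oneForm m) h hP (fun j => hdd _) (fun j => hdd _),
    ← prod_coe_sort (sievePrimes N W)]
  rw [Fintype.prod_congr _ _ (fun p => localDensity₀_eq_expect h dd p)]
  rw [← CFZ.expect_pi_prod (fun (p : sievePrimes N W) (u : ZMod (p : ℕ)) =>
    ∏ v ∈ univ.filter (fun v => (p : ℕ) ∣ dd v), corrInd W h (CFZ.slotIdx v) p u)]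
  refine expect_congr rfl fun ω _ => ?_
  unfold indProd
  rw [prod_prod_mem_eq_prod_prod_filter (fun v => primeSet (sievePrimes N W) (dd v))
    (fun v p => corrInd W h (CFZ.slotIdx v) p (ω p))]
  refine prod_congr rfl fun p _ => prod_congr ?_ fun _ _ => rfl
  ext v
  simp [mem_primeSet]

/-- A tuple with an entry outside `squarefreeOf (sievePrimes N W)` contributes nothing to `mainSum`:
either an entry is not square-free (`c = 0`), or a prime `q ∣ W` divides an entry (the weight
vanishes: `θ ≡ 1 (mod q)`). [cite: GreenTaoAnnals2008, Section 10] -/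
theorem summand_eq_zero_of_not_mem {R : ℝ} (hN : N = ⌊R⌋₊) (h : Fin m → ℤ) {dd : Fin m ⊕ Fin m → ℕ}
    (hdd : dd ∈ Fintype.piFinset (fun _ : Fin m ⊕ Fin m => Icc 1 ⌊R⌋₊))
    (hnot : dd ∉ Fintype.piFinset (fun _ : Fin m ⊕ Fin m => sqfLevel N W)) :
    (∏ v, corrCoef R (dd v)) *
        CFZ.tupleDensity W (oneForm m) h (fun j => dd (Sum.inl j)) (fun j => dd (Sum.inr j)) = 0 := by
  classical
  rw [Fintype.mem_piFinset] at hdd hnot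
  push Not at hnot
  obtain ⟨v₀, hv₀⟩ := hnot
  have hdd' : ∀ v, 1 ≤ dd v ∧ dd v ≤ N := fun v => by rw [hN]; exact mem_Icc.1 (hdd v)
  by_cases hsq : ∀ v, Squarefree (dd v)
  · -- all entries square-free: a prime of `W` divides `dd v₀`
    have hnsf : dd v₀ ∉ CFZ.squarefreeOf (sievePrimes N W) := fun h' => hv₀ (mem_sqfLevel.2 ⟨h', (hdd' v₀).2⟩)
    rw [CFZ.mem_squarefreeOf (sievePrimes_prime N W)] at hnsf
    push Not at hnsf
    have hsub := hnsf (hsq v₀)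
    rw [not_subset] at hsub
    obtain ⟨q, hq, hqP⟩ := hsub
    have hqp : q.Prime := Nat.prime_of_mem_primeFactors hq
    have hqd : q ∣ dd v₀ := Nat.dvd_of_mem_primeFactors hq
    have hqN : q ≤ N := (Nat.le_of_dvd (hdd' v₀).1 hqd).trans (hdd' v₀).2
    have hqW : q ∣ W := by
      by_contra hqW
      exact hqP (mem_sievePrimes.2 ⟨hqp, hqN, hqW⟩)
    -- all entries lie in `squarefreeOf (primes ≤ N)`
    set P' : Finset ℕ := Nat.primesBelow (N + 1) with hP'
    have hP'p : ∀ p ∈ P', p.Prime := fun p hp => (Nat.mem_primesBelow.1 hp).2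
    have hmem : ∀ v, dd v ∈ CFZ.squarefreeOf P' := fun v =>
      (CFZ.mem_squarefreeOf hP'p).2 ⟨hsq v, fun p hp =>
        Nat.mem_primesBelow.2 ⟨Nat.lt_succ_of_le ((Nat.le_of_mem_primeFactors hp).trans (hdd' v).2),
          Nat.prime_of_mem_primeFactors hp⟩⟩
    rw [CFZ.tupleDensity_eq_prod_localDensity W (oneForm m) h hP'p (fun j => hmem _) (fun j => hmem _)]
    have hqP' : q ∈ P' := Nat.mem_primesBelow.2 ⟨Nat.lt_succ_of_le hqN, hqp⟩
    rw [prod_eq_zero hqP', mul_zero]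
    haveI : Fact q.Prime := ⟨hqp⟩
    rw [CFZ.localDensity₀_eq]
    refine CFZ.localDensity_eq_zero_of_dvd hqW (oneForm m) h ?_
    refine ⟨CFZ.slotIdx v₀, ?_⟩
    rcases v₀ with j | j
    · exact mem_union_left _ (by simpa [CFZ.pattern, CFZ.slotIdx] using hqd)
    · exact mem_union_right _ (by simpa [CFZ.pattern, CFZ.slotIdx] using hqd)
  · push Not at hsq
    obtain ⟨v, hv⟩ := hsq
    rw [prod_eq_zero (mem_univ v) (corrCoef_eq_zero_of_not_squarefree R hv), zero_mul]

/-- **Step 2a**: `mainSum` is a sum over tuples of square-free numbers of the model.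
[cite: GreenTaoAnnals2008, Section 10] -/
theorem mainSum_eq_sum_sqfLevel {R : ℝ} (hN : N = ⌊R⌋₊) (h : Fin m → ℤ) :
    mainSum R W h = ∑ dd ∈ Fintype.piFinset (fun _ : Fin m ⊕ Fin m => sqfLevel N W),
      (∏ v, corrCoef R (dd v)) * CFZ.tupleDensity W (oneForm m) h (fun j => dd (Sum.inl j)) (fun j => dd (Sum.inr j)) := by
  unfold mainSum
  symm
  refine sum_subset (Fintype.piFinset_subset _ _ fun _ => ?_) fun dd hdd hnot => summand_eq_zero_of_not_mem hN h hdd hnot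
  intro d hd
  rw [hN] at hd
  obtain ⟨h1, h2⟩ := mem_sqfLevel.1 hd
  exact mem_Icc.2 ⟨Nat.pos_of_ne_zero ((CFZ.mem_squarefreeOf (sievePrimes_prime _ W)).1 h1).1.ne_zero, h2⟩

/-- **Step 2b**: `mainSum = E_ω ∏_i (Σ_{d ∈ sqfLevel} c(d) ∏_{p ∣ d} I_i(p, ω_p))²`.
[cite: GreenTaoAnnals2008, Section 10] -/
theorem mainSum_eq_expect_sq {R : ℝ} (hN : N = ⌊R⌋₊) (h : Fin m → ℤ) :
    mainSum R W h = 𝔼 ω : (∀ p : sievePrimes N W, ZMod (p : ℕ)),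
      ∏ i, (∑ d ∈ sqfLevel N W, corrCoef R d * indProd W h i d ω) ^ 2 := by
  classical
  rw [mainSum_eq_sum_sqfLevel hN]
  have hmem : ∀ dd ∈ Fintype.piFinset (fun _ : Fin m ⊕ Fin m => sqfLevel N W), ∀ v,
      dd v ∈ CFZ.squarefreeOf (sievePrimes N W) := fun dd hdd v =>
    (mem_sqfLevel.1 (Fintype.mem_piFinset.1 hdd v)).1
  rw [sum_congr rfl fun dd hdd => by rw [tupleDensity_eq_expect h (hmem dd hdd), mul_expect]]
  rw [← expect_sum_comm]
  refine expect_congr rfl fun ω _ => ?_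
  have hsq : ∏ i, (∑ d ∈ sqfLevel N W, corrCoef R d * indProd W h i d ω) ^ 2 =
      ∏ v : Fin m ⊕ Fin m, (∑ d ∈ sqfLevel N W, corrCoef R d * indProd W h (CFZ.slotIdx v) d ω) := by
    rw [Fintype.prod_sum_type]
    simp only [CFZ.slotIdx, Sum.elim_inl, Sum.elim_inr, id, ← prod_mul_distrib, sq]
  rw [hsq, prod_univ_sum]
  refine sum_congr rfl fun dd _ => ?_
  rw [prod_mul_distrib]

/-- **Step 2c (numbers ↔ sets of primes)**: the inner sum over `sqfLevel` is the sum over all sets of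
primes of the model with the weights `lamSet` (which vanish beyond `R`).
[cite: GreenTaoAnnals2008, Section 10] -/
theorem sum_sqfLevel_eq_sum_lamSet {R : ℝ} (hN : N = ⌊R⌋₊) (h : Fin m → ℤ) (i : Fin m)
    (ω : ∀ p : sievePrimes N W, ZMod (p : ℕ)) :
    ∑ d ∈ sqfLevel N W, corrCoef R d * indProd W h i d ω =
      ∑ V : Finset (sievePrimes N W), lamSet R V * ∏ p ∈ V, corrInd W h i p (ω p) := by
  classical
  have hP := sievePrimes_prime N W
  -- the right-hand side through the dictionary
  have h1 : ∑ V : Finset (sievePrimes N W), lamSet R V * ∏ p ∈ V, corrInd W h i p (ω p) =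
      ∑ V : Finset (sievePrimes N W), (fun d => corrCoef R d * indProd W h i d ω) (setProd V) := by
    refine Fintype.sum_congr _ _ fun V => ?_
    simp only [lamSet_def, indProd]
    rw [primeSet_setProd hP]
  rw [h1, sum_finsetSubtype_eq_sum_squarefreeOf hP (fun d => corrCoef R d * indProd W h i d ω)]
  -- restrict to `d ≤ N`
  symm
  rw [← sum_filter_of_ne (p := fun d => d ≤ N) (fun d hd hne => ?_)]
  · refine sum_congr ?_ fun _ _ => rfl
    ext d
    rw [mem_filter, mem_sqfLevel]
  · by_contra hdN
    apply hne
    rw [corrCoef_def, if_neg, zero_mul]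
    intro hdR
    apply hdN
    rw [hN]
    exact Nat.le_floor hdR

/-- **The main term as an expectation over the product space**:
`mainSum = E_ω ∏_i (Σ_V Λ(V) ∏_{p ∈ V} I_i(p, ω_p))²`. [cite: GreenTaoAnnals2008, Section 10] -/
theorem mainSum_eq_expect {R : ℝ} (hN : N = ⌊R⌋₊) (h : Fin m → ℤ) :
    mainSum R W h = 𝔼 ω : (∀ p : sievePrimes N W, ZMod (p : ℕ)),
      ∏ i, (∑ V : Finset (sievePrimes N W), lamSet R V * ∏ p ∈ V, corrInd W h i p (ω p)) ^ 2 := by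
  rw [mainSum_eq_expect_sq hN]
  refine expect_congr rfl fun ω _ => Fintype.prod_congr _ _ fun i => ?_
  rw [sum_sqfLevel_eq_sum_lamSet hN]

end Model

/-! ### Step 3: the local factors -/

section LocalFactors

variable {N W : ℕ}

/-- The exceptional primes: `p ∣ h_i − h_j` for some `i ≠ j` (the primes dividing `Δ`).
[cite: GreenTaoAnnals2008, Proposition 9.6] -/
def IsExcPrime (h : Fin m → ℤ) (p : ℕ) : Prop := ∃ i j : Fin m, i ≠ j ∧ (p : ℤ) ∣ h i - h j

/-- The indicator family of the model, in the format of `GreenTao2008CorrelationCore`.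
[cite: GreenTaoAnnals2008, Section 10 (10.3)] -/
def modelInd (W : ℕ) (h : Fin m → ℤ) : Fin m → (p : sievePrimes N W) → ZMod (p : ℕ) → ℝ :=
  fun i p u => corrInd W h i p u

/-- **The local factor at a prime of the model**: with `a = 1/p`, `r = (1 − a)⁻¹ = p/(p−1)`,
`Σ_Y r^{|Y|} |M_p(Y)| ≤ r^m (1 + coreConst m / p²) · (1 + excConst m / p)^{[p exceptional]}`.
[cite: GreenTaoAnnals2008, Proposition 9.6 (weak form)] -/
theorem local_factor_le (h : Fin m → ℤ) (p : sievePrimes N W) [Decidable (IsExcPrime h p)] :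
    ∑ Y : Finset (Fin m ⊕ Fin m), (1 - 1 / ((p : ℕ) : ℝ))⁻¹ ^ #Y *
        |localMoment (modelInd W h) (fun q => 1 / ((q : ℕ) : ℝ)) p Y| ≤
      (1 - 1 / ((p : ℕ) : ℝ))⁻¹ ^ m * (1 + coreConst m / ((p : ℕ) : ℝ) ^ 2) *
        (if IsExcPrime h p then 1 + excConst m / ((p : ℕ) : ℝ) else 1) := by
  haveI := fact_prime_coe_sievePrimes p
  have hp := prime_of_mem_sievePrimes p.2
  have hpW : ¬ (p : ℕ) ∣ W := (mem_sievePrimes.1 p.2).2.2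
  have hp2 : (2 : ℝ) ≤ ((p : ℕ) : ℝ) := by exact_mod_cast hp.two_le
  have hp0 : (0 : ℝ) < ((p : ℕ) : ℝ) := by linarith
  have ha0 : (0 : ℝ) < 1 / ((p : ℕ) : ℝ) := by positivity
  have ha2 : 1 / ((p : ℕ) : ℝ) ≤ 1 / 2 := one_div_le_one_div_of_le two_pos hp2
  have ha1 : 1 / ((p : ℕ) : ℝ) ≤ 1 := by linarith
  obtain ⟨hr1, -, -⟩ := inv_one_sub_bounds ha0 ha2
  -- the hypotheses of the local lemmas
  have hJ : ∀ i u, modelInd W h i p u = 0 ∨ modelInd W h i p u = 1 := fun i u => corrInd_eq_zero_or_one W h i p u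
  have hE1 : ∀ i, 𝔼 u : ZMod (p : ℕ), modelInd W h i p u = 1 / ((p : ℕ) : ℝ) := fun i => expect_corrInd hpW h i
  have hE : ∀ U : Finset (Fin m ⊕ Fin m), U.Nonempty →
      𝔼 u : ZMod (p : ℕ), ∏ v ∈ U, modelInd W h (CFZ.slotIdx v) p u ≤ 1 / ((p : ℕ) : ℝ) :=
    fun U hU => expect_prod_corrInd_le hpW h hU
  have hrm : 1 ≤ (1 - 1 / ((p : ℕ) : ℝ))⁻¹ ^ m * (1 + coreConst m / ((p : ℕ) : ℝ) ^ 2) := by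
    have h1 : 1 ≤ (1 - 1 / ((p : ℕ) : ℝ))⁻¹ ^ m := one_le_pow₀ hr1
    have h2 : 1 ≤ 1 + coreConst m / ((p : ℕ) : ℝ) ^ 2 := le_add_of_nonneg_right (div_nonneg (coreConst_nonneg m) (by positivity))
    nlinarith
  have hsq : coreConst m * (1 / ((p : ℕ) : ℝ)) ^ 2 = coreConst m / ((p : ℕ) : ℝ) ^ 2 := by
    rw [one_div_pow]; ring
  simp only [localMoment_eq_locMoment]
  by_cases hexc : IsExcPrime h p
  · rw [if_pos hexc]
    have hgen := sum_pow_mul_abs_locMoment_le_general (fun i => modelInd W h i p) hJ ha0.le ha1 hr1 hE1 hE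
    have hnum := general_factor_le (m := m) ha0 ha2
    have hexcF : 1 + excConst m * (1 / ((p : ℕ) : ℝ)) = 1 + excConst m / ((p : ℕ) : ℝ) := by ring
    calc _ ≤ 1 + 4 ^ m * ((1 - 1 / ((p : ℕ) : ℝ))⁻¹ ^ (2 * m) *
          ((1 / ((p : ℕ) : ℝ)) ^ 2 + 1 / ((p : ℕ) : ℝ) * (1 + 1 / ((p : ℕ) : ℝ)) ^ (2 * m))) := hgen
      _ ≤ 1 + excConst m / ((p : ℕ) : ℝ) := by rw [← hexcF]; exact hnum
      _ = 1 * (1 + excConst m / ((p : ℕ) : ℝ)) := (one_mul _).symm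
      _ ≤ _ := mul_le_mul_of_nonneg_right hrm (by
          have : 0 ≤ excConst m / ((p : ℕ) : ℝ) := div_nonneg (excConst_nonneg m) hp0.le
          linarith)
  · rw [if_neg hexc, mul_one]
    have hgen' : ∀ i j : Fin m, i ≠ j → ¬ ((p : ℕ) : ℤ) ∣ h i - h j := fun i j hij hdvd =>
      hexc ⟨i, j, hij, hdvd⟩
    have hgenU : ∀ U : Finset (Fin m ⊕ Fin m), (∃ v ∈ U, ∃ v' ∈ U, CFZ.slotIdx v ≠ CFZ.slotIdx v') →
        𝔼 u : ZMod (p : ℕ), ∏ v ∈ U, modelInd W h (CFZ.slotIdx v) p u = 0 :=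
      fun U hU => expect_prod_corrInd_eq_zero hpW h hgen' hU
    have hgen := sum_pow_mul_abs_locMoment_le_generic (fun i => modelInd W h i p) hJ ha0.le ha1 hr1 hE1 hE hgenU
    have hnum := generic_factor_le (m := m) ha0 ha2
    rw [hsq] at hnum
    exact hgen.trans hnum

end LocalFactors

/-! ### Step 4: Mertens-type products and the bound for the main term -/

section MainBound

/-- The primes dividing some `h_i − h_j`, `i ≠ j` — for distinct `h_i`, the primes dividing
`Δ = ∏_{i<j} |h_i − h_j|` (the same `Finset` as `pairPrimeFactors` of `GreenTao2008MajorantProofs`).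
[cite: GreenTaoAnnals2008, Proposition 9.6] -/
def corrPairPrimes (h : Fin m → ℤ) : Finset ℕ :=
  (univ : Finset (Fin m × Fin m)).biUnion fun ij => (h ij.1 - h ij.2).natAbs.primeFactors

/-- An exceptional prime of the model divides `Δ`. [cite: GreenTaoAnnals2008, Proposition 9.6] -/
theorem mem_corrPairPrimes_of_isExcPrime {h : Fin m → ℤ} (hinj : Function.Injective h) {p : ℕ} (hp : p.Prime)
    (hexc : IsExcPrime h p) : p ∈ corrPairPrimes h := by
  obtain ⟨i, j, hij, hdvd⟩ := hexc
  unfold corrPairPrimes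
  rw [mem_biUnion]
  refine ⟨(i, j), mem_univ _, Nat.mem_primeFactors.2 ⟨hp, ?_, ?_⟩⟩
  · exact Int.natCast_dvd.1 hdvd
  · exact Int.natAbs_ne_zero.2 (sub_ne_zero.2 fun heq => hij (hinj heq))

/-- `1/p ≤ p^{-1/2}` for `p ≥ 1`. [folklore] -/
theorem one_div_le_rpow_neg_half {p : ℕ} (hp : 1 ≤ p) : 1 / (p : ℝ) ≤ (p : ℝ) ^ (-(1 / 2 : ℝ)) := by
  have hp0 : (0 : ℝ) < p := by exact_mod_cast hp
  rw [Real.rpow_neg hp0.le, one_div]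
  apply inv_anti₀ (by positivity)
  calc (p : ℝ) ^ (1 / 2 : ℝ) ≤ (p : ℝ) ^ (1 : ℝ) :=
      Real.rpow_le_rpow_of_exponent_le (by exact_mod_cast hp) (by norm_num)
    _ = p := Real.rpow_one _

/-- `Σ_{p ∈ P} C/p² ≤ C` for a set `P` of primes (`Σ_p 1/(p(p−1)) ≤ 1`). [folklore] -/
theorem sum_div_sq_le {P : Finset ℕ} (hP : ∀ p ∈ P, p.Prime) {N : ℕ} (hPN : ∀ p ∈ P, p ≤ N) {C : ℝ} (hC : 0 ≤ C) :
    ∑ p ∈ P, C / (p : ℝ) ^ 2 ≤ C := by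
  have hsub : P ⊆ Nat.primesLE N := fun p hp => Nat.mem_primesLE.2 ⟨hPN p hp, hP p hp⟩
  have h1 := Literature.NumberTheory.LFunctions.MertensBound.sum_inv_prime_mul_pred_le_one N
  calc ∑ p ∈ P, C / (p : ℝ) ^ 2 ≤ ∑ p ∈ Nat.primesLE N, C / (p : ℝ) ^ 2 :=
        sum_le_sum_of_subset_of_nonneg hsub fun p _ _ => by positivity
    _ ≤ ∑ p ∈ Nat.primesLE N, C * (1 / ((p : ℝ) * (p - 1))) := by
        refine sum_le_sum fun p hp => ?_
        have hp2 : (2 : ℝ) ≤ p := by exact_mod_cast (Nat.mem_primesLE.1 hp).2.two_le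
        rw [div_eq_mul_one_div]
        refine mul_le_mul_of_nonneg_left (one_div_le_one_div_of_le (by nlinarith) (by nlinarith)) hC
    _ = C * ∑ p ∈ Nat.primesLE N, 1 / ((p : ℝ) * (p - 1)) := by rw [mul_sum]
    _ ≤ C * 1 := mul_le_mul_of_nonneg_left h1 hC
    _ = C := mul_one C

/-- **Mertens for the model**: if every prime factor of `W ≠ 0` is `≤ N` and `N ≥ 2`, then
`(W/φ(W)) ∏_{p ≤ N, p ∤ W} (1 − 1/p)⁻¹ = ∏_{p ≤ N} (1 − 1/p)⁻¹ ≤ e⁵ log N`.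
[cite: GreenTaoAnnals2008, Proposition 9.6 (weak form)] -/
theorem totient_mul_prod_sievePrimes_le {N W : ℕ} (hW : W ≠ 0) (hWN : ∀ p ∈ W.primeFactors, p ≤ N) (hN : 2 ≤ N) :
    (W : ℝ) / W.totient * ∏ p ∈ sievePrimes N W, (1 - 1 / (p : ℝ))⁻¹ ≤ Real.exp 5 * Real.log N := by
  have hfac : ∀ p : ℕ, p.Prime → (0 : ℝ) < 1 - 1 / (p : ℝ) := by
    intro p hp
    have hp2 : (2 : ℝ) ≤ p := by exact_mod_cast hp.two_le
    have : 1 / (p : ℝ) ≤ 1 / 2 := one_div_le_one_div_of_le two_pos hp2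
    linarith
  -- `W/φ(W) = ∏_{p ∣ W} (1 - 1/p)⁻¹`
  have hWφ : (W : ℝ) / W.totient = ∏ p ∈ W.primeFactors, (1 - 1 / (p : ℝ))⁻¹ := by
    rw [Literature.NumberTheory.LFunctions.MertensBound.totient_eq_mul_prod_one_sub_inv, prod_inv_distrib,
      div_mul_eq_div_div, div_self (by exact_mod_cast hW), one_div]
  -- `sievePrimes ⊔ primeFactors W = primesLE N`
  have hS : sievePrimes N W = (Nat.primesLE N).filter (fun p => ¬ p ∣ W) := by
    ext p; rw [mem_sievePrimes, mem_filter, Nat.mem_primesLE]; tauto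
  have hT : W.primeFactors = (Nat.primesLE N).filter (fun p => p ∣ W) := by
    ext p
    rw [Nat.mem_primeFactors, mem_filter, Nat.mem_primesLE]
    constructor
    · rintro ⟨hp, hpW, -⟩
      exact ⟨⟨hWN p (Nat.mem_primeFactors.2 ⟨hp, hpW, hW⟩), hp⟩, hpW⟩
    · rintro ⟨⟨-, hp⟩, hpW⟩
      exact ⟨hp, hpW, hW⟩
  have hprod : (W : ℝ) / W.totient * ∏ p ∈ sievePrimes N W, (1 - 1 / (p : ℝ))⁻¹ =
      ∏ p ∈ Nat.primesLE N, (1 - 1 / (p : ℝ))⁻¹ := by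
    rw [hWφ, hS, hT]
    exact prod_filter_mul_prod_filter_not (Nat.primesLE N) (fun p => p ∣ W) _
  rw [hprod, prod_inv_distrib]
  have hM := Literature.NumberTheory.LFunctions.MertensBound.exp_neg_div_log_le_prod_one_sub_inv N hN
  have hN' : (2 : ℝ) ≤ N := by exact_mod_cast hN
  have hlogN : 0 < Real.log N := Real.log_pos (by linarith)
  have hpos : 0 < Real.exp (-5) / Real.log N := by positivity
  calc (∏ p ∈ Nat.primesLE N, (1 - 1 / (p : ℝ)))⁻¹ ≤ (Real.exp (-5) / Real.log N)⁻¹ := inv_anti₀ hpos hM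
    _ = Real.exp 5 * Real.log N := by rw [inv_div, Real.exp_neg, div_inv_eq_mul, mul_comm]

variable {N W : ℕ}

/-- **The bound for the main term**: for `R ≥ 2`, `W ≥ 1` with all prime factors `≤ ⌊R⌋`, and
distinct `h_i`,
`mainSum ≤ 49^m e^{coreConst m + 5m} (W/φ(W))^m (log R)^{-m} ∏_{p ∣ Δ} (1 + excConst m · p^{-1/2})`.
[cite: GreenTaoAnnals2008, Proposition 9.6 (weak form)] -/
theorem mainSum_le {R : ℝ} (hR : 2 ≤ R) (hW : W ≠ 0) (hWR : ∀ p ∈ W.primeFactors, p ≤ ⌊R⌋₊)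
    (h : Fin m → ℤ) (hinj : Function.Injective h) :
    mainSum R W h ≤ 49 ^ m * Real.exp (coreConst m + 5 * m) * ((W : ℝ) / W.totient) ^ m / Real.log R ^ m *
      ∏ p ∈ corrPairPrimes h, (1 + excConst m * (p : ℝ) ^ (-(1 / 2 : ℝ))) := by
  classical
  set N : ℕ := ⌊R⌋₊ with hN
  have hR1 : 1 < R := by linarith
  have hN2 : 2 ≤ N := by rw [hN]; exact Nat.le_floor (by exact_mod_cast hR)
  have hlogR : 0 < Real.log R := Real.log_pos hR1
  have hP := sievePrimes_prime N W
  set Z : ℝ := 7 * ((W : ℝ) / W.totient) / Real.log R with hZ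
  have hφ0 : (0 : ℝ) < W.totient := by exact_mod_cast Nat.totient_pos.2 (Nat.pos_of_ne_zero hW)
  have hWφ1 : 1 ≤ (W : ℝ) / W.totient := by
    rw [le_div_iff₀ hφ0, one_mul]; exact_mod_cast Nat.totient_le W
  have hZ0 : 0 ≤ Z := by positivity
  -- Step C: the core bound
  have hcore := expect_prod_sq_le_of_zCoeff_le (modelInd W h) (fun (q : sievePrimes N W) => 1 / ((q : ℕ) : ℝ))
    (lamSet R) (fun (q : sievePrimes N W) => (1 - 1 / ((q : ℕ) : ℝ))⁻¹) Z hZ0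
    (fun T => abs_zCoeff_lamSet_le hR1 hW hN T)
  rw [mainSum_eq_expect hN h]
  refine hcore.trans ?_
  -- Step L: local factors
  have hloc : ∏ p : sievePrimes N W, ∑ Y : Finset (Fin m ⊕ Fin m), (1 - 1 / ((p : ℕ) : ℝ))⁻¹ ^ #Y *
        |localMoment (modelInd W h) (fun q => 1 / ((q : ℕ) : ℝ)) p Y| ≤
      ∏ p : sievePrimes N W, ((1 - 1 / ((p : ℕ) : ℝ))⁻¹ ^ m * (1 + coreConst m / ((p : ℕ) : ℝ) ^ 2) *
        (if IsExcPrime h p then 1 + excConst m / ((p : ℕ) : ℝ) else 1)) :=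
    prod_le_prod (fun p _ => sum_nonneg fun Y _ => mul_nonneg (pow_nonneg (by
      have := (inv_one_sub_bounds (a := 1 / ((p : ℕ) : ℝ)) (by have := (hP p p.2).pos; positivity)
        (one_div_le_one_div_of_le two_pos (by exact_mod_cast (hP p p.2).two_le))).1
      linarith) _) (abs_nonneg _)) fun p _ => local_factor_le h p
  refine (mul_le_mul_of_nonneg_left hloc (pow_nonneg hZ0 _)).trans ?_
  rw [prod_mul_distrib, prod_mul_distrib, prod_pow]
  -- the three products, over the `Finset`
  rw [prod_coe_sort (sievePrimes N W) (fun p => (1 - 1 / (p : ℝ))⁻¹),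
    prod_coe_sort (sievePrimes N W) (fun p => 1 + coreConst m / (p : ℝ) ^ 2),
    prod_coe_sort (sievePrimes N W) (fun p => if IsExcPrime h p then 1 + excConst m / (p : ℝ) else 1)]
  -- (M1)
  have hM1 : ∏ p ∈ sievePrimes N W, (1 + coreConst m / (p : ℝ) ^ 2) ≤ Real.exp (coreConst m) := by
    refine (SquarefreeSums.prod_one_add_le_exp_sum fun p _ => by
      exact div_nonneg (coreConst_nonneg m) (by positivity)).trans ?_
    exact Real.exp_le_exp.2 (sum_div_sq_le hP (fun p hp => (mem_sievePrimes.1 hp).2.1) (coreConst_nonneg m))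
  -- (M2)
  have hM2 : ∏ p ∈ sievePrimes N W, (if IsExcPrime h p then 1 + excConst m / (p : ℝ) else 1) ≤
      ∏ p ∈ corrPairPrimes h, (1 + excConst m * (p : ℝ) ^ (-(1 / 2 : ℝ))) := by
    rw [← prod_filter]
    calc ∏ p ∈ (sievePrimes N W).filter (fun p => IsExcPrime h p), (1 + excConst m / (p : ℝ))
        ≤ ∏ p ∈ (sievePrimes N W).filter (fun p => IsExcPrime h p), (1 + excConst m * (p : ℝ) ^ (-(1 / 2 : ℝ))) := by
          refine prod_le_prod (fun p _ => by
            have : 0 ≤ excConst m / (p : ℝ) := div_nonneg (excConst_nonneg m) (Nat.cast_nonneg _)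
            linarith) fun p hp => ?_
          have hp1 : 1 ≤ p := (hP p (mem_filter.1 hp).1).one_lt.le
          rw [div_eq_mul_one_div]
          exact add_le_add le_rfl (mul_le_mul_of_nonneg_left (one_div_le_rpow_neg_half hp1) (excConst_nonneg m))
      _ ≤ ∏ p ∈ corrPairPrimes h, (1 + excConst m * (p : ℝ) ^ (-(1 / 2 : ℝ))) := by
          refine prod_le_prod_of_subset_of_one_le (fun p hp => ?_)
            (fun p _ => add_nonneg zero_le_one (mul_nonneg (excConst_nonneg m) (Real.rpow_nonneg (Nat.cast_nonneg _) _)))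
            (fun p _ _ => le_add_of_nonneg_right (mul_nonneg (excConst_nonneg m) (Real.rpow_nonneg (Nat.cast_nonneg _) _)))
          obtain ⟨hp1, hp2⟩ := mem_filter.1 hp
          exact mem_corrPairPrimes_of_isExcPrime hinj (hP p hp1) hp2
  -- (M3)
  have hM3 : (W : ℝ) / W.totient * ∏ p ∈ sievePrimes N W, (1 - 1 / (p : ℝ))⁻¹ ≤ Real.exp 5 * Real.log R := by
    refine (totient_mul_prod_sievePrimes_le hW hWR hN2).trans ?_
    refine mul_le_mul_of_nonneg_left (Real.log_le_log (by positivity) ?_) (Real.exp_pos _).le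
    exact Nat.floor_le (by linarith)
  -- assemble
  have hprod0 : 0 ≤ ∏ p ∈ sievePrimes N W, (1 - 1 / (p : ℝ))⁻¹ :=
    prod_nonneg fun p hp => by
      have hp2 : (2 : ℝ) ≤ p := by exact_mod_cast (hP p hp).two_le
      have : 1 / (p : ℝ) ≤ 1 / 2 := one_div_le_one_div_of_le two_pos hp2
      exact inv_nonneg.2 (by linarith)
  set Pr := ∏ p ∈ sievePrimes N W, (1 - 1 / (p : ℝ))⁻¹ with hPr
  set E1 := ∏ p ∈ sievePrimes N W, (1 + coreConst m / (p : ℝ) ^ 2) with hE1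
  set E2 := ∏ p ∈ sievePrimes N W, (if IsExcPrime h p then 1 + excConst m / (p : ℝ) else 1) with hE2
  set F := ∏ p ∈ corrPairPrimes h, (1 + excConst m * (p : ℝ) ^ (-(1 / 2 : ℝ))) with hF
  have hE10 : 0 ≤ E1 := prod_nonneg fun p _ => by
    have : 0 ≤ coreConst m / (p : ℝ) ^ 2 := div_nonneg (coreConst_nonneg m) (by positivity)
    linarith
  have hE20 : 0 ≤ E2 := prod_nonneg fun p _ => by
    split_ifs
    · have : 0 ≤ excConst m / (p : ℝ) := div_nonneg (excConst_nonneg m) (Nat.cast_nonneg _); linarith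
    · norm_num
  -- `Z^{2m} Pr^m = (49 X/L² · X Pr)^m ≤ (49 X/L² · e⁵ L)^m = 49^m e^{5m} X^m / L^m` (`X = W/φ(W)`, `L = log R`)
  set X : ℝ := (W : ℝ) / W.totient with hX
  set L : ℝ := Real.log R with hL
  have hkey : Z ^ (2 * m) * Pr ^ m ≤ 49 ^ m * Real.exp (5 * m) * X ^ m / L ^ m := by
    have hb : Z ^ (2 * m) * Pr ^ m = (49 * X / L ^ 2 * (X * Pr)) ^ m := by
      rw [pow_mul, ← mul_pow]
      congr 1
      rw [hZ]
      field_simp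
      ring
    have hc0 : 0 ≤ 49 * X / L ^ 2 := by positivity
    have hb' : 49 * X / L ^ 2 * (X * Pr) ≤ 49 * X / L ^ 2 * (Real.exp 5 * L) := mul_le_mul_of_nonneg_left hM3 hc0
    have heq : 49 * X / L ^ 2 * (Real.exp 5 * L) = 49 * Real.exp 5 * X / L := by
      field_simp
    rw [hb]
    calc (49 * X / L ^ 2 * (X * Pr)) ^ m ≤ (49 * X / L ^ 2 * (Real.exp 5 * L)) ^ m :=
          pow_le_pow_left₀ (mul_nonneg hc0 (mul_nonneg (by positivity) hprod0)) hb' m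
      _ = (49 * Real.exp 5 * X / L) ^ m := by rw [heq]
      _ = 49 ^ m * Real.exp (5 * m) * X ^ m / L ^ m := by
          rw [div_pow, mul_pow, mul_pow, ← Real.exp_nat_mul, mul_comm (m : ℝ) 5]
  calc Z ^ (2 * m) * (Pr ^ m * E1 * E2) = (Z ^ (2 * m) * Pr ^ m) * (E1 * E2) := by ring
    _ ≤ (49 ^ m * Real.exp (5 * m) * X ^ m / L ^ m) * (Real.exp (coreConst m) * F) :=
        mul_le_mul hkey (mul_le_mul hM1 hM2 hE20 (Real.exp_pos _).le) (mul_nonneg hE10 hE20) (by positivity)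
    _ = 49 ^ m * Real.exp (coreConst m + 5 * m) * X ^ m / L ^ m * F := by
        rw [Real.exp_add]; ring

end MainBound

/-! ### Step 5: the correlation estimate -/

section Final

/-- The constant `C_m` of the correlation estimate. [cite: GreenTaoAnnals2008, Proposition 9.6 (weak form)] -/
def corrConst (m : ℕ) : ℝ := 49 ^ m * Real.exp (coreConst m + 5 * m) + 8 ^ m

/-- `corrConst m ≥ 1`. [cite: GreenTaoAnnals2008, Proposition 9.6 (weak form)] -/
theorem one_le_corrConst (m : ℕ) : 1 ≤ corrConst m := by
  unfold corrConst
  have h1 : (1 : ℝ) ≤ 8 ^ m := one_le_pow₀ (by norm_num)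
  have h2 : (0 : ℝ) ≤ 49 ^ m * Real.exp (coreConst m + 5 * m) := by positivity
  linarith

/-- **Green–Tao 2008, Proposition 9.6 up to the constant (the Goldston–Yıldırım correlation estimate
for `Λ_R`), PROVED.** For `m ≥ 0`, `R ≥ 2`, `W ≥ 1` all of whose prime factors are `≤ R`, distinct
integers `h_1, …, h_m`, and an integer interval `[a, a + ℓ)` of length `ℓ ≥ R^{5m}`,

  `E_{x ∈ [a,a+ℓ)} ∏_i Λ_R(W(x + h_i) + 1)² ≤ C_m (W log R/φ(W))^m ∏_{p ∣ Δ} (1 + C'_m p^{-1/2})`,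

`Δ = ∏_{i<j} |h_i − h_j|` (the product is over `corrPairPrimes h`, the primes dividing some
`h_i − h_j`, `i ≠ j`), with `C_m = corrConst m`, `C'_m = excConst m`. The source prints
`(1 + o_m(1))` for `C_m` (for `N → ∞` with `w(N) → ∞` slowly) and proves it by contour integration
(§10, Appendix); the present weaker statement — all that Proposition 9.10 uses — is proved by the
elementary argument of `GreenTao2008CorrelationCore/Local` and Steps 1–4 above.
[cite: GreenTaoAnnals2008, Proposition 9.6 (weak form)] -/
theorem correlation_bound {R : ℝ} (hR : 2 ≤ R) {W : ℕ} (hW : W ≠ 0) (hWR : ∀ p ∈ W.primeFactors, p ≤ ⌊R⌋₊)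
    (h : Fin m → ℤ) (hinj : Function.Injective h) (a : ℤ) {ℓ : ℕ} (hℓ : R ^ (5 * m) ≤ ℓ) :
    𝔼 x ∈ Ico a (a + ℓ), ∏ i, truncatedDivisorSum R (W * (x + h i) + 1) ^ 2 ≤
      corrConst m * ((W : ℝ) * Real.log R / W.totient) ^ m *
        ∏ p ∈ corrPairPrimes h, (1 + excConst m * (p : ℝ) ^ (-(1 / 2 : ℝ))) := by
  have hR1 : 1 < R := by linarith
  set L : ℝ := Real.log R with hL
  set X : ℝ := (W : ℝ) / W.totient with hX
  set F : ℝ := ∏ p ∈ corrPairPrimes h, (1 + excConst m * (p : ℝ) ^ (-(1 / 2 : ℝ))) with hF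
  set M : ℝ := mainSum R W h with hMdef
  have hL0 : 0 < L := Real.log_pos hR1
  have hφ0 : (0 : ℝ) < W.totient := by exact_mod_cast Nat.totient_pos.2 (Nat.pos_of_ne_zero hW)
  have hX1 : 1 ≤ X := by rw [hX, le_div_iff₀ hφ0, one_mul]; exact_mod_cast Nat.totient_le W
  have hF1 : 1 ≤ F := one_le_prod fun p _ =>
    le_add_of_nonneg_right (mul_nonneg (excConst_nonneg m) (Real.rpow_nonneg (Nat.cast_nonneg _) _))
  have hF0 : 0 ≤ F := zero_le_one.trans hF1
  -- Step 1: main term plus error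
  have hℓ2 : R ^ (2 * m) ≤ ℓ := le_trans (pow_le_pow_right₀ hR1.le (by omega)) hℓ
  have habs := abs_expect_prod_sq_sub_main_le hR1 W h a hℓ2
  have hE : 𝔼 x ∈ Ico a (a + ℓ), ∏ i, truncatedDivisorSum R (W * (x + h i) + 1) ^ 2 ≤
      L ^ (2 * m) * M + L ^ (2 * m) * (R ^ (4 * m) / ℓ) := by
    have := (abs_le.1 habs).2
    linarith
  -- the main term
  have hM : M ≤ 49 ^ m * Real.exp (coreConst m + 5 * m) * X ^ m / L ^ m * F := mainSum_le hR hW hWR h hinj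
  have hmain : L ^ (2 * m) * M ≤ 49 ^ m * Real.exp (coreConst m + 5 * m) * (X * L) ^ m * F := by
    calc L ^ (2 * m) * M ≤ L ^ (2 * m) * (49 ^ m * Real.exp (coreConst m + 5 * m) * X ^ m / L ^ m * F) :=
          mul_le_mul_of_nonneg_left hM (pow_nonneg hL0.le _)
      _ = 49 ^ m * Real.exp (coreConst m + 5 * m) * (X * L) ^ m * F := by
          rw [pow_mul, mul_pow]
          field_simp
          ring
  -- the error term
  have herr : L ^ (2 * m) * (R ^ (4 * m) / ℓ) ≤ 8 ^ m * (X * L) ^ m * F := by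
    have hR0 : (0 : ℝ) < R := by linarith
    have hℓ0 : (0 : ℝ) < ℓ := lt_of_lt_of_le (pow_pos hR0 _) hℓ
    have h1 : L ^ (2 * m) * (R ^ (4 * m) / ℓ) ≤ (4 : ℝ) ^ m := by
      have hL2 : L ^ (2 * m) ≤ (4 * R) ^ m := by
        rw [pow_mul]
        exact pow_le_pow_left₀ (sq_nonneg _) (Literature.NumberTheory.Transcendental.log_sq_le_four_mul hR1.le) m
      calc L ^ (2 * m) * (R ^ (4 * m) / ℓ) ≤ (4 * R) ^ m * (R ^ (4 * m) / R ^ (5 * m)) :=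
            mul_le_mul hL2 (div_le_div_of_nonneg_left (by positivity) (pow_pos hR0 _) hℓ) (by positivity) (by positivity)
        _ = 4 ^ m := by
            rw [mul_pow, show 5 * m = m + 4 * m by ring, pow_add]
            field_simp
    have h2 : (4 : ℝ) ^ m ≤ 8 ^ m * (X * L) ^ m := by
      have hlog2 : (1 / 2 : ℝ) ≤ L := by
        have := Real.log_two_gt_d9
        have : Real.log 2 ≤ L := Real.log_le_log two_pos hR
        linarith
      have hXL : 1 / 2 ≤ X * L := by nlinarith
      calc (4 : ℝ) ^ m = 8 ^ m * (1 / 2) ^ m := by rw [← mul_pow]; norm_num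
        _ ≤ 8 ^ m * (X * L) ^ m := by gcongr
    calc L ^ (2 * m) * (R ^ (4 * m) / ℓ) ≤ 8 ^ m * (X * L) ^ m := h1.trans h2
      _ = 8 ^ m * (X * L) ^ m * 1 := (mul_one _).symm
      _ ≤ 8 ^ m * (X * L) ^ m * F := mul_le_mul_of_nonneg_left hF1 (by positivity)
  -- conclusion
  have hXL : (W : ℝ) * Real.log R / W.totient = X * L := by rw [hX, hL]; ring
  rw [hXL]
  calc _ ≤ L ^ (2 * m) * M + L ^ (2 * m) * (R ^ (4 * m) / ℓ) := hE
    _ ≤ 49 ^ m * Real.exp (coreConst m + 5 * m) * (X * L) ^ m * F + 8 ^ m * (X * L) ^ m * F := add_le_add hmain herr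
    _ = corrConst m * (X * L) ^ m * F := by unfold corrConst; ring

end Final

end Literature.NumberTheory.Sieve.GreenTao2008
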